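import Literature.Computability.Cryptography.OracleSimIndexed
import Literature.Computability.Complexity.OracleClockFst
import HarnessLib

/-!
# Emulating a game adversary with an indexed oracle, II: the clock read off the game input

Topic `Literature/Computability/Cryptography`; sequel of `OracleSimIndexed.lean` (`OracleAlg.simM`: the emulated
adversary clocked at `q(|w|)` rounds, `w` its whole machine input). An `OracleAdversary` of the tree runs its step
function on the PAIR `w = ⟨x, coins⟩` for `fuel(|x|)` rounds — the budget is a polynomial of the GAME INPUT `x`, not of
the pair (`OracleGames.lean`; `Complexity/OracleClockFst.lean`, `OracleAlg.clockFst`). This file provides the variant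
of the emulation clocked by the first field:

* `OracleAlg.queriesAux_clockBy_eq`, `queries_clockFst_boolPair` — the exact transcript of the clocked algorithm
  (`OracleClockFst.lean` has the run, `run_clockFst_boolPair`, and the subset form of the transcript);
* **`OracleAlg.simMFst M e q d f h`** `= postOutS ((((M.mapQuery keepIdx).mapAnswers f).mapOut e).clockFst q d) h`,
  `isPolyTime_simMFst`, and **`run_simMFst`**: on `⟨x, r⟩`, within any budget beyond `q(|x|)`, it outputs
  `h ⟨⟨x, r⟩, ⟨listBool (answer records), w⟩⟩` for the run of `M` against the indexed oracle `(i, q) ↦ f (O ⟨1ⁱ, q⟩)`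
  for `q(|x|)` rounds (`w` the re-presented output, `d` on a time-out), and its transcript is the tagged one.

All proved; no named facts.

## References

* S. Arora, B. Barak, *Computational Complexity: A Modern Approach*, CUP 2009, §3.4 with §1.4.1 and Def. 7.1.
* O. Goldreich, *Foundations of Cryptography II*, CUP 2004, §6.1.3; proofs of Prop. 6.4.15 / 6.4.17.
-/

namespace Literature.Computability.Complexity

open _root_.Computability Polynomial Brick

namespace OracleAlg

variable {β : Type}

/-- **The exact transcript of `M.clockBy t b₀`**: with a total budget beyond the clock it asks exactly the queries `M`
asks in the rounds the clock allows. [Arora–Barak 2009, §3.4 with §1.4.1] [folklore] -/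
theorem queriesAux_clockBy_eq (M : OracleAlg β) (t : List Bool → ℕ) (b₀ : β) (O : Oracle) (w : List Bool) :
    ∀ (m n : ℕ) (as : List (List Bool)), as.length + m = t w → m < n →
      (M.clockBy t b₀).queriesAux O w n as = M.queriesAux O w m as
  | m, 0, as, _, hn => by omega
  | 0, n + 1, as, h, _ => by
    unfold queriesAux
    rw [clockBy_step, if_neg (by omega)]
  | m + 1, n + 1, as, h, hn => by
    unfold queriesAux
    rw [clockBy_step, if_pos (by omega)]
    cases M.step w as with
    | inr b => rfl
    | inl y =>
      dsimp only
      rw [queriesAux_clockBy_eq M t b₀ O w m n _ (by simp; omega) (by omega)]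

/-- The transcript of `M.clockFst q b₀` on a pair input `⟨x, r⟩`. [folklore] -/
theorem queries_clockFst_boolPair (M : OracleAlg β) (q : Polynomial ℕ) (b₀ : β) (O : Oracle) (x r : List Bool) {n : ℕ}
    (hn : q.eval x.length < n) : (M.clockFst q b₀).queries O n (boolPair x r) = M.queries O (q.eval x.length) (boolPair x r) := by
  have h := queriesAux_clockBy_eq M (fun w => q.eval (boolUnpair w).1.length) b₀ O (boolPair x r) (q.eval x.length) n []
    (by simp) hn
  simpa [clockFst, queries] using h

/-- **The emulated adversary, clocked by the game input**: as `simM` but with `clockFst` (budget `q(|x|)` on `⟨x, r⟩`).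
[Goldreich 2004, proofs of Prop. 6.4.15 / 6.4.17; Arora–Barak 2009, §3.4, Def. 7.1] [folklore] -/
noncomputable def simMFst (M : OracleAlg β) (e : β → List Bool) (q : Polynomial ℕ) (d : List Bool) (f h : List Bool → List Bool) :
    OracleAlg (List Bool) :=
  postOutS ((((M.mapQuery keepIdx).mapAnswers f).mapOut e).clockFst q d) h

/-- **`simMFst` is polynomial-time** (as `isPolyTime_simM`). [Arora–Barak 2009, §3.4 with §1.3] [cite: AroraBarak2009, §3.4] -/
theorem isPolyTime_simMFst {eb : Encoding β Bool} {M : OracleAlg β} (hM : M.IsPolyTime eb) {e : β → List Bool}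
    (he : ∀ b, e b = eb.encode b) (q : Polynomial ℕ) (d : List Bool) {f h : List Bool → List Bool} (hf : f ∈ FP)
    (hfl : ∀ a, (f a).length ≤ a.length) (hh : h ∈ FP) : (simMFst M e q d f h).IsPolyTime (encodingList Bool) :=
  isPolyTime_postOutS (isPolyTime_clockFst (encodingList Bool)
    (IsPolyTime.mapOut (isPolyTime_mapAnswers (isPolyTime_mapQuery eb hM keepIdx_mem_FP) hf hfl) e he) q d) hh

/-- **The run of `simMFst`** on `⟨x, r⟩` against a plain oracle `O`, within any budget beyond `q(|x|)`: it outputs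
`h ⟨⟨x, r⟩, ⟨listBool (answer records), w⟩⟩`, the answer records being `O ⟨1ⁱ, qᵢ⟩` on the queries `qᵢ` of `M` run for
`q(|x|)` rounds against the indexed oracle `(i, q) ↦ f (O ⟨1ⁱ, q⟩)`, and `w` being `e` of `M`'s output in that run (or
`d`); its transcript is the tagged one. [Goldreich 2004, proofs of Prop. 6.4.15 / 6.4.17] [folklore] -/
theorem run_simMFst (M : OracleAlg β) (e : β → List Bool) (q : Polynomial ℕ) (d : List Bool) (f h : List Bool → List Bool)
    (O : Oracle) (x r : List Bool) {n : ℕ} (hn : q.eval x.length < n) :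
    (simMFst M e q d f h).run O n (boolPair x r) = some (h (boolPair (boolPair x r) (boolPair
      ((encodingList Bool).listBool.encode (answersOf O (M.queriesIdx (idxOracle (f ∘ O)) (q.eval x.length) (boolPair x r))))
      (((M.runIdx (idxOracle (f ∘ O)) (q.eval x.length) (boolPair x r)).map e).getD d)))) ∧
    (simMFst M e q d f h).queries O n (boolPair x r) = tagFrom 0 (M.queriesIdx (idxOracle (f ∘ O)) (q.eval x.length) (boolPair x r)) := by
  set N := ((M.mapQuery keepIdx).mapAnswers f).mapOut e with hN
  have hNrun : N.run O (q.eval x.length) (boolPair x r) = (M.runIdx (idxOracle (f ∘ O)) (q.eval x.length) (boolPair x r)).map e := by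
    rw [hN, run, runAux_mapOut, runAux_mapAnswers, List.map_nil, runAux_mapQuery_keepIdx]; rfl
  have hNq : N.queries O (q.eval x.length) (boolPair x r) = tagFrom 0 (M.queriesIdx (idxOracle (f ∘ O)) (q.eval x.length) (boolPair x r)) := by
    rw [hN, queries, queriesAux_mapOut, queriesAux_mapAnswers, List.map_nil, queriesAux_mapQuery_keepIdx]; rfl
  have hC : (N.clockFst q d).run O n (boolPair x r) = some (((M.runIdx (idxOracle (f ∘ O)) (q.eval x.length) (boolPair x r)).map e).getD d) := by
    rw [run_clockFst_boolPair N q d O x r hn, hNrun]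
  have hCq : (N.clockFst q d).queries O n (boolPair x r) = tagFrom 0 (M.queriesIdx (idxOracle (f ∘ O)) (q.eval x.length) (boolPair x r)) := by
    rw [queries_clockFst_boolPair N q d O x r hn, hNq]
  have h := runAux_postOutS (N.clockFst q d) h O (boolPair x r) n [] _ hC
  rw [List.nil_append] at h
  refine ⟨?_, ?_⟩
  · rw [simMFst, ← hN, run, h.1]
    unfold queries at hCq
    rw [hCq]
    rfl
  · rw [simMFst, ← hN, queries, h.2]
    exact hCq

end OracleAlg

end Literature.Computability.Complexity
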